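import Literature.NumberTheory.DiophantineGeometry.BcgpSwitchingSurface
import Literature.NumberTheory.FaltingsSerre.ParamodularBridge
import Literature.NumberTheory.Automorphic.IsAutomorphicAE
import HarnessLib

/-!
# Venture ResidMod — the MOD-3 flag (surjective image): certificate slots for Boxer–Calegari–Gee–Pilloni
# 2025, Thm. 1.1.1 ("`ρ̄_{A,3}` surjective, `Frob₂` not of class `4C/12C`, good ordinary and
# `3`-distinguished at `3` ⟹ `A` modular"), and the verdict as an implication

HONEST FRAMING. Interface file of a COMPUTATION cell (`pub-residmod`). NO surface is claimed modular here
and NO image is computed here. The published theorem is NOT yet a named fact of the tree: it is SPELLED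
OUT below as the hypothesis `h111` of the verdict (the cell's LIT seat files it under
`Literature/NumberTheory/DiophantineGeometry/` as `bcgp2025_modular_of_surjective_modThree`; when that
lands, `h111` is discharged by it or by a one-line adapter). Every datum about a surface is a binder
(the fields of `Mod3SurjectiveCertificate`); the theorem below only checks that the census certificate's
slots COMPOSE with the printed hypotheses to give the printed conclusion, in the tree's vocabulary.
In print the theorem rests on Arthur's classification for `GSp₄` / the twisted weighted fundamental
lemma (loc. cit. §1.6).

THE PRINTED THEOREM [BCGP 2025 = arXiv:2502.20645, Thm. 1.1.1, p. 3, verbatim]: "Let `A/ℚ` be an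
abelian surface with a polarization of degree prime to `3`. Suppose the following holds: (1) The mod `3`
representation `ρ̄_{A,3} : Gal(ℚ̄/ℚ) → GSp₄(𝔽₃)` is surjective. (2) `ρ̄_{A,3}|_{G_{ℚ₂}}` is unramified,
and the characteristic polynomial of `ρ̄_{A,3}(Frob₂)` is not `(x² ± x + 2)²`. (3) `A` has good ordinary
reduction at `3` and the characteristic polynomial of Frobenius at `3` does not have repeated roots. Then
`A` is modular. More precisely, there exists a cuspidal automorphic representation `π` for `GL₄/ℚ` (the
transfer of a cuspidal automorphic representation of `GSp₄/ℚ` of weight `2`) such that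
`L(s,H¹(A)) = L(s,π)`."  (§9.5, p. 136: "if `ρ̄_{A,3}` is surjective, then `End(A_ℚ̄) = ℤ` is
automatic"; §10.1, p. 138: the theorem "applies to the Jacobians of precisely `11743` of the `66158`
genus two curves in [LMFDB]".)

RENDERING (binder `h111` of `modular_of_mod3SurjectiveCertificate`; the points a reviewer should attack):
* `A : AbelianVariety ℚ`, `A.dim = 2`; `ρ̄_{A,3}` is a framed continuous `ρb : Γ_ℚ → GL₄(𝔽₃)`
  together with a CONTRAGREDIENT torsion frame `e₃ : A[3](ℚ̄) ≃ (ℤ/3)⁴`, `e₃ (g • P) = ρb(g⁻¹)ᵀ e₃ P`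
  (§1.8.11: `ρ̄_{A,p}` is the representation on `A[p]^∨`; VERBATIM the clause (2)(a) of the tree's
  `bcgp_switchingSurface_exists`);
* "polarization of degree prime to `3`" is rendered by what it is used for: `ρb` preserves a
  non-degenerate alternating form up to the multiplier `ε̄⁻¹` (`IsSymplecticWithMultiplierFun` with the
  inverse mod-`3` cyclotomic character, VERBATIM the first hypothesis of `bcgp_switch_exists_modular_abelianSurface`);
* (1) "surjective onto `GSp₄(𝔽₃)`": the image has `103680 = |GSp₄(𝔽₃)|` elements (inside the
  similitude group of the form, of that order, so this IS surjectivity onto it);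
* (2) `ρb` unramified at the place over `2` and every Frobenius characteristic polynomial there is
  `≠ (X² + X + 2)²`, `≠ (X² − X + 2)²` (VERBATIM the third hypothesis of `bcgp_switch_exists_modular_abelianSurface`);
* (3) good ordinary reduction at the place over `3` (`HasGoodOrdinaryReductionAt`) and integers `a, b`
  with `L₃(A,T) = 1 − aT + bT² − 3aT³ + 9T⁴` the good Euler factor at `3` (`HasGoodEulerFactorAt`) whose
  reciprocal `Q₃(x) = x⁴ − ax³ + bx² − 3ax + 9` (`eulerPolynomialOfSurface 3 a b`, "the characteristic
  polynomial of Frobenius at `3`") is separable over `ℚ` ("does not have repeated roots"; = the cell's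
  flag DIST0(3), lead ruling R4: the characteristic-`0` notion of Def. 9.1.2, "`Q(x)` is not a square");
* CONCLUSION in the summit's almost-everywhere `GL₄` form, VERBATIM the conclusion clause of
  `bcgp_residuallyA5b_modular_abelianSurface` (Thm. 8.3.2): every framed dual `r` of every `V_p(A)` is
  `IsAutomorphicAE ι hcpt r`.

THE CERTIFICATE (`Mod3SurjectiveCertificate A`, one field per slot of the cell's format
`cert/CERT-FORMAT-v0.md` / PLAN §2: TORS3 frame, POL, SURJ3 (verdict `SURJECTIVE`: observed Frobenius
classes + the checker's proof that no proper subgroup with surjective similitude meets them — checked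
OFFLINE by two implementations, a binder here), UNRAM2, F2OK, GOOD∧ORD(3), `L₃`, DIST0(3)). Kernel
content of this file is deliberately thin (composition only); the numeric dischargers (F2OK from
`(a₂,b₂) mod 3`, DIST0(3) by a Bézout pair for `Q₃, Q₃'`) belong to the per-surface instance files.

References: [BoxerCalegariGeePilloni2025] arXiv:2502.20645 Thm. 1.1.1 (p. 3), Thm. 9.5.2 and §9.5
(p. 136), Lemma 9.1.3, Def. 9.1.2 (p. 125), §1.8.11, §10.1 (p. 138); cell HOME
`run/shared/lean/pub/pub-residmod/` (PLAN.md §2 T-L, A2 R4).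
-/

noncomputable section

namespace Summit.Ventures.ResidMod

open CategoryTheory IsDedekindDomain Field Polynomial
open scoped NumberField Matrix
open Literature.NumberTheory.GaloisRepresentations Literature.NumberTheory.Automorphic
open Literature.NumberTheory.DiophantineGeometry Literature.NumberTheory.FaltingsSerre
open Literature.AlgebraicGeometry.Motives (AbelianVariety)

/-- **Mod-3 certificate, surjective image** (hypothesis structure, D-0014): the slots of the cell's
certificate for the flag T-L, as binders about `A`. `rho` with `frame` says "`rho` is `ρ̄_{A,3}` on
`A[3]^∨`" (contragredient torsion frame, §1.8.11); `symplectic` = the Weil pairing of a polarization of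
degree prime to `3` makes `ρ̄_{A,3}` symplectic with multiplier `ε̄⁻¹`; `card_range` = verdict SURJECTIVE
(`|im ρ̄| = |GSp₄(𝔽₃)| = 103680`); `unramifiedAt_two`, `frobCharpoly_two` = hypothesis (2);
`ordinary_three` = good ordinary reduction at `3`; `a₃, b₃, euler_three` = the Euler factor
`L₃(A,T) = 1 − a₃T + b₃T² − 3a₃T³ + 9T⁴`; `separable_three` = `Q₃` has no repeated root (DIST0(3)).
Nothing here asserts that an instance exists. [cite: BoxerCalegariGeePilloni2025, Thm. 1.1.1 (hypotheses (1)–(3)); §1.8.11; Def. 9.1.2] -/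
structure Mod3SurjectiveCertificate (A : AbelianVariety ℚ) where
  /-- `ρ̄_{A,3} : Γ_ℚ → GL₄(𝔽₃)`, framed and continuous. -/
  rho : FramedGaloisRep ℚ (ZMod 3) 4
  /-- TORS3: `rho` is the Galois action on `A[3]^∨` — contragredient torsion frame. -/
  frame : ∃ e₃ : A.geomTorsion (3 : ℕ) ≃+ (Fin 4 → ZMod 3),
    ∀ (g : absoluteGaloisGroup ℚ) (P : A.geomTorsion (3 : ℕ)),
      e₃ (g • P) = ((rho g⁻¹ : GL (Fin 4) (ZMod 3)) : Matrix (Fin 4) (Fin 4) (ZMod 3))ᵀ *ᵥ e₃ P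
  /-- POL: symplectic with multiplier `ε̄⁻¹` (Weil pairing of a polarization of degree prime to `3`). -/
  symplectic : rho.IsSymplecticWithMultiplierFun
    (fun g => (((modPCyclotomicCharacterZMod ℚ 3 g)⁻¹ : (ZMod 3)ˣ) : ZMod 3))
  /-- SURJ3: the image has `|GSp₄(𝔽₃)| = 103680` elements. -/
  card_range : Nat.card (Set.range rho) = 103680
  /-- UNRAM2: `ρ̄_{A,3}` is unramified at the place above `2`. -/
  unramifiedAt_two : ∀ v : HeightOneSpectrum (𝓞 ℚ), ((2 : ℕ) : 𝓞 ℚ) ∈ v.asIdeal → rho.IsUnramifiedAt v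
  /-- F2OK: no Frobenius at `2` has characteristic polynomial `(X² ± X + 2)²` (classes `4C/12C`). -/
  frobCharpoly_two : ∀ v : HeightOneSpectrum (𝓞 ℚ), ((2 : ℕ) : 𝓞 ℚ) ∈ v.asIdeal →
    ∀ Q : Polynomial (ZMod 3), rho.HasFrobCharpolyAt v Q →
      Q ≠ (X ^ 2 + X + 2) ^ 2 ∧ Q ≠ (X ^ 2 - X + 2) ^ 2
  /-- GOOD(3) ∧ ORD(3): good ordinary reduction at the place above `3`. -/
  ordinary_three : ∀ v : HeightOneSpectrum (𝓞 ℚ), ((3 : ℕ) : 𝓞 ℚ) ∈ v.asIdeal →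
    A.HasGoodOrdinaryReductionAt v
  /-- `a₃ = a₃(A)` (trace of Frobenius at `3`). -/
  a₃ : ℤ
  /-- `b₃ = b₉(A)` (middle coefficient of `L₃`). -/
  b₃ : ℤ
  /-- `L₃(A,T) = 1 − a₃T + b₃T² − 3a₃T³ + 9T⁴` is the good Euler factor of `A` at `3`. -/
  euler_three : A.HasGoodEulerFactorAt 3 ((lPolynomialOfSurface 3 a₃ b₃).map (Int.castRingHom ℚ))
  /-- DIST0(3): `Q₃(x) = x⁴ − a₃x³ + b₃x² − 3a₃x + 9` has no repeated root. -/
  separable_three : (eulerPolynomialOfSurface 3 a₃ b₃ : Polynomial ℚ).Separable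

/-- **VERDICT (mod-3 flag, surjective image): a certified surface is modular, GIVEN BCGP 2025
Thm. 1.1.1.** The binder `h111` is that theorem SPELLED OUT in the tree's vocabulary (module docstring:
contragredient torsion frame; polarization ↦ symplectic with multiplier `ε̄⁻¹`; (1) `|im| = 103680`;
(2) unramified at `2`, Frobenius polynomials `≠ (X² ± X + 2)²`; (3) good ordinary at `3`, Euler factor
`L₃` with separable reciprocal `Q₃`; conclusion = every framed dual of every `V_p(A)` automorphic almost
everywhere on `GL₄(𝔸_ℚ)`), NOT proved in the tree and NOT yet a named fact (the LIT seat files it); the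
certificate `C` supplies (1)–(3) slot by slot. CONDITIONAL on `h111`; every datum is a binder.
[cite: BoxerCalegariGeePilloni2025, Thm. 1.1.1 p. 3; §9.5 p. 136 (End(A_ℚ̄) = ℤ automatic); §1.8.11] -/
theorem modular_of_mod3SurjectiveCertificate
    (h111 : ∀ (A : AbelianVariety ℚ), A.dim = 2 →
      ∀ (ρb : FramedGaloisRep ℚ (ZMod 3) 4),
        (∃ e₃ : A.geomTorsion (3 : ℕ) ≃+ (Fin 4 → ZMod 3),
          ∀ (g : absoluteGaloisGroup ℚ) (P : A.geomTorsion (3 : ℕ)),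
            e₃ (g • P) =
              ((ρb g⁻¹ : GL (Fin 4) (ZMod 3)) : Matrix (Fin 4) (Fin 4) (ZMod 3))ᵀ *ᵥ e₃ P) →
        ρb.IsSymplecticWithMultiplierFun
            (fun g => (((modPCyclotomicCharacterZMod ℚ 3 g)⁻¹ : (ZMod 3)ˣ) : ZMod 3)) →
        Nat.card (Set.range ρb) = 103680 →
        (∀ v : HeightOneSpectrum (𝓞 ℚ), ((2 : ℕ) : 𝓞 ℚ) ∈ v.asIdeal →
          ρb.IsUnramifiedAt v ∧
            ∀ Q : Polynomial (ZMod 3), ρb.HasFrobCharpolyAt v Q →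
              Q ≠ (X ^ 2 + X + 2) ^ 2 ∧ Q ≠ (X ^ 2 - X + 2) ^ 2) →
        (∀ v : HeightOneSpectrum (𝓞 ℚ), ((3 : ℕ) : 𝓞 ℚ) ∈ v.asIdeal →
          A.HasGoodOrdinaryReductionAt v) →
        (∃ a b : ℤ, A.HasGoodEulerFactorAt 3 ((lPolynomialOfSurface 3 a b).map (Int.castRingHom ℚ)) ∧
          (eulerPolynomialOfSurface 3 a b : Polynomial ℚ).Separable) →
        ∀ (p : ℕ) [Fact p.Prime] (b : Module.Basis (Fin 4) ℚ_[p] (A.rationalTateModule p))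
          (r : FramedGaloisRep ℚ (PadicAlgCl p) 4),
          (∀ g : absoluteGaloisGroup ℚ,
            (r g).val =
              ((LinearMap.toMatrix b b (A.rationalTateRep p g⁻¹)).map
                (algebraMap ℚ_[p] (PadicAlgCl p))).transpose) →
          ∀ (hcpt : isCompact_glFiniteIntegralLevel 4 ℚ) (ι : PadicAlgCl p ≃+* ℂ),
            ∃ π : CuspidalAutomorphicRepData 4 ℚ hcpt, π.1.IsLAlgebraic ∧
              ∀ᶠ v : HeightOneSpectrum (𝓞 ℚ) in Filter.cofinite, ∃ a : Multiset ℂ,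
                π.1.HasSatakeParamAt v a ∧ r.IsUnramifiedAt v ∧
                  r.HasFrobCharpolyAt v (arithFrobPolyOfSatake ι v.residueCard 1 a))
    (A : AbelianVariety ℚ) (hA : A.dim = 2) (C : Mod3SurjectiveCertificate A) :
    ∀ (p : ℕ) [Fact p.Prime] (b : Module.Basis (Fin 4) ℚ_[p] (A.rationalTateModule p))
      (r : FramedGaloisRep ℚ (PadicAlgCl p) 4),
      (∀ g : absoluteGaloisGroup ℚ,
        (r g).val =
          ((LinearMap.toMatrix b b (A.rationalTateRep p g⁻¹)).map
            (algebraMap ℚ_[p] (PadicAlgCl p))).transpose) →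
      ∀ (hcpt : isCompact_glFiniteIntegralLevel 4 ℚ) (ι : PadicAlgCl p ≃+* ℂ),
        IsAutomorphicAE ι hcpt r := by
  intro p _ b r hr hcpt ι
  exact h111 A hA C.rho C.frame C.symplectic C.card_range
    (fun v hv => ⟨C.unramifiedAt_two v hv, C.frobCharpoly_two v hv⟩) C.ordinary_three
    ⟨C.a₃, C.b₃, C.euler_three, C.separable_three⟩ p b r hr hcpt ι

/-- Numeric form of DIST0(3) for certificates: `Q₃ = X⁴ − aX³ + bX² − 3aX + 9` over `ℚ` is separable as
soon as a Bézout pair `u Q₃ + v Q₃' = 1` is exhibited (this is the definition of `Polynomial.Separable`;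
per-surface instance files discharge it by `ring`-checking an explicit pair). [folklore] -/
theorem separable_eulerPolynomial_of_bezout (a b : ℤ) (u v : Polynomial ℚ)
    (h : u * (eulerPolynomialOfSurface 3 a b : Polynomial ℚ) +
      v * Polynomial.derivative (eulerPolynomialOfSurface 3 a b : Polynomial ℚ) = 1) :
    (eulerPolynomialOfSurface 3 a b : Polynomial ℚ).Separable :=
  ⟨u, v, h⟩

end Summit.Ventures.ResidMod

end
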